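/-
Copyright (c) 2026 the pub-hodgecm-mathlib formalisation cell (harness21).  Prover seat hodgecm-mathlib-LH4-p13 (g9), req620 Track A «(D-RAM) FOUR-FRAME» squad
((β₂) road (R-36); β₂ sub-dealer LH4-p04 (g9) 22:17:22Z (4) ∕ 22:35:19Z: the ED. 2 cut «`beta2ConesB ⟸ OFF-ROW ZERO + ROW b = m∕2`» — its arithmetic shell), 2026-09-04.
-/
import Mathlib.Algebra.BigOperators.Ring.Finset
import Mathlib.Algebra.Order.BigOperators.Group.Finset
import Mathlib.Algebra.BigOperators.Intervals
import HarnessLib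

/-!
# Crux `H413`, line LH4 «(D-RAM) FOUR-FRAME» — STAGE-1b, row (2), the (β₂) road, β₂-BOARD row (L-Σ-3B) ED. 2: «THE CONE SUM IS ITS ROW» —
# if every cone cell off the tube depth `b₀` vanishes, the cone sum `Σ_{b ∈ [1,R]} Σ_{j<J+1} [P j]·a j b` is the single row `Σ_{j<J+1} [P j]·a j b₀`, so two cone sums
# with OFF-ROW ZERO and equal ROWS agree

Cell `hodgecm-mathlib` (D-0151), FLOOR 0, crux item H413 = `stmt-HodgeConjecture-24833`, route of record `HCCMUnconditional`; squad F0∕P3c∕LH4; lane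
`--supports stmt-HodgeConjecture-24833 --as helper` (count-neutral; pays NO tier-0 row).  THEOREMS ONLY (no `def`, no instance, no notation, no `sorry`, default heartbeats).
PURE FINSET ALGEBRA over `ℤ` — no field, no lattice: the cone summand is an abstract `a : ℕ → ℕ → ℤ` (cell `(j, b)`, order level `j`, tube depth `b ≥ 1`) behind an abstract
level predicate `P j` (the socket's `IsOrd ρ α (jE ϖ ^ j) lam`), exactly the shape of the two sides of `beta2ConesB.letter.v1` (LH4-p04 (g9), 9aed41864e374e6a).

WHY (β₂ sub-dealer LH4-p04 (g9) 22:17:22Z (4), 22:35:19Z).  After ★-cand `hbeta2CellsBNear_of_cones` the RamK lane of (β₂) is the GENERIC cone ledger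
`Σ_{b∈[1,R]} Σ_{j<J+1} [P j]·cellDiff₁(j,b) = Σ_{b∈[1,R′]} Σ_{j<J+1} [P j]·cellDiff₂(j,b)`; the announced ED. 2 cut pays it from TWO facts per literal — OFF-ROW ZERO
(every cone cell with tube depth `b ≠ b₀ := m∕2` contributes `0`) and the ROW identity at `b₀` (signed totals agree; evidence: every labelled-unbalanced cell of the RamK
q = 2 ∕ q = 4 engine runs sits at `b = m∕2`, LH4-cdis1 (g0) ∕ F0P3-p01 (g37)).  THIS FILE is the arithmetic of that cut, typed once (sibling of ★ p861530
`F0P3cDyRamCellSumArithmetic`, which shells the older list-ledger cut):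
* §1 `sum_range_ite_eq_zero_of_forall` — a level column whose every `P`-cell vanishes is `0`;
  `coneSum_eq_row_of_offRow_zero` — OFF-ROW ZERO with `b₀ ∈ [1,R]` ⟹ cone sum `=` row `b₀`; `coneSum_eq_zero_of_offRow_zero_of_not_mem` — OFF-ROW ZERO with
  `b₀ ∉ [1,R]` ⟹ cone sum `= 0`.
* §2 HEADS `coneSum_eq_coneSum_of_offRow_zero_of_row` (both rows inside their boxes) and the box-free form `coneSum_eq_coneSum_of_offRow_zero_of_row_ite`
  (row identity stated with the membership guards, covering a row outside one or both boxes).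
HONEST LABEL.  Arithmetic only; nothing printed is asserted; no census value is stated; OFF-ROW ZERO and the ROW identity are HYPOTHESES here; (β₂) ∕ `beta2ConesB`
UNPROVED; `HC_CM` is proved only modulo the 7 printed citations (2 remaining named inputs: hLiu418 = `stmt-HodgeConjecture-24832`, h413 = `stmt-HodgeConjecture-24833`)
until rung 0 closes.
## References
* [Kottwitz1986BaseChangeUnits] R. E. Kottwitz, *Base change for unit elements of Hecke algebras*, Compositio Math. 60 (1986), §1 pp. 240–241 (the lattice-count
  bookkeeping, cell by cell).
* [Rogawski1990] J. D. Rogawski, *Automorphic Representations of Unitary Groups in Three Variables*, Ann. of Math. Stud. 123 (1990), §4.9 Prop. 4.9.1 (b) p. 55.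
-/

set_option autoImplicit false

namespace Summit.HodgeConjecture.HodgeConjecture.Cruxes.H413.F0P3cDyRamConeSumRowArithmetic

open Finset

/-! ## §1 OFF-ROW ZERO collapses the cone sum to its row -/

/-- **A LEVEL COLUMN WHOSE `P`-CELLS VANISH IS `0`**: if `a j b = 0` whenever `j < J + 1` and `P j`, then `Σ_{j<J+1} [P j]·a j b = 0`.
[cite: Kottwitz1986BaseChangeUnits, §1 pp. 240–241] -/
theorem sum_range_ite_eq_zero_of_forall (P : ℕ → Prop) [DecidablePred P] (a : ℕ → ℕ → ℤ) (J b : ℕ)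
    (h0 : ∀ j ∈ range (J + 1), P j → a j b = 0) :
    ∑ j ∈ range (J + 1), (if P j then a j b else 0) = 0 := by
  refine sum_eq_zero fun j hj => ?_
  split_ifs with hP
  · exact h0 j hj hP
  · rfl

/-- **OFF-ROW ZERO ⟹ THE CONE SUM IS ITS ROW** (`b₀ ∈ [1, R]`): if every cone cell `(j, b)` with `b ∈ [1,R]`, `b ≠ b₀`, `j < J+1`, `P j` has `a j b = 0`, then
`Σ_{b∈[1,R]} Σ_{j<J+1} [P j]·a j b = Σ_{j<J+1} [P j]·a j b₀` (★ `Finset.sum_eq_single_of_mem`). [cite: Kottwitz1986BaseChangeUnits, §1 pp. 240–241] -/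
theorem coneSum_eq_row_of_offRow_zero (P : ℕ → Prop) [DecidablePred P] (a : ℕ → ℕ → ℤ) (J R b₀ : ℕ) (hb₀ : b₀ ∈ Icc 1 R)
    (hoff : ∀ b ∈ Icc 1 R, b ≠ b₀ → ∀ j ∈ range (J + 1), P j → a j b = 0) :
    ∑ b ∈ Icc 1 R, ∑ j ∈ range (J + 1), (if P j then a j b else 0) = ∑ j ∈ range (J + 1), (if P j then a j b₀ else 0) :=
  sum_eq_single_of_mem b₀ hb₀ fun b hb hne => sum_range_ite_eq_zero_of_forall P a J b (hoff b hb hne)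

/-- **OFF-ROW ZERO WITH THE ROW OUTSIDE THE BOX ⟹ THE CONE SUM IS `0`** (`b₀ ∉ [1, R]`: then every cell of the box is off-row).
[cite: Kottwitz1986BaseChangeUnits, §1 pp. 240–241] -/
theorem coneSum_eq_zero_of_offRow_zero_of_not_mem (P : ℕ → Prop) [DecidablePred P] (a : ℕ → ℕ → ℤ) (J R b₀ : ℕ) (hb₀ : b₀ ∉ Icc 1 R)
    (hoff : ∀ b ∈ Icc 1 R, b ≠ b₀ → ∀ j ∈ range (J + 1), P j → a j b = 0) :
    ∑ b ∈ Icc 1 R, ∑ j ∈ range (J + 1), (if P j then a j b else 0) = 0 :=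
  sum_eq_zero fun b hb => sum_range_ite_eq_zero_of_forall P a J b (hoff b hb (fun hbb => hb₀ (hbb ▸ hb)))

/-- **THE CONE SUM AS A GUARDED ROW**: under OFF-ROW ZERO, `Σ_{b∈[1,R]} Σ_{j<J+1} [P j]·a j b = Σ_{j<J+1} [P j]·(if b₀ ∈ [1,R] then a j b₀ else 0)` — both cases of the
two lemmas above in one line. [cite: Kottwitz1986BaseChangeUnits, §1 pp. 240–241] -/
theorem coneSum_eq_row_ite_of_offRow_zero (P : ℕ → Prop) [DecidablePred P] (a : ℕ → ℕ → ℤ) (J R b₀ : ℕ)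
    (hoff : ∀ b ∈ Icc 1 R, b ≠ b₀ → ∀ j ∈ range (J + 1), P j → a j b = 0) :
    ∑ b ∈ Icc 1 R, ∑ j ∈ range (J + 1), (if P j then a j b else 0) =
      ∑ j ∈ range (J + 1), (if P j then (if b₀ ∈ Icc 1 R then a j b₀ else 0) else 0) := by
  by_cases hb₀ : b₀ ∈ Icc 1 R
  · rw [coneSum_eq_row_of_offRow_zero P a J R b₀ hb₀ hoff]
    exact sum_congr rfl fun j _ => by rw [if_pos hb₀]
  · rw [coneSum_eq_zero_of_offRow_zero_of_not_mem P a J R b₀ hb₀ hoff]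
    symm
    refine sum_eq_zero fun j _ => ?_
    rw [if_neg hb₀]
    split_ifs <;> rfl

/-! ## §2 HEADS — OFF-ROW ZERO on both sides and the ROW identity give the cone ledger -/

/-- **HEAD — «OFF-ROW ZERO + ROW ⟹ THE CONE LEDGER»** (both rows inside their boxes).  Two cone-sum shapes with common level predicate `P` and level range `J`: `a` up to tube
depth `R` and `h` up to `R′`; a common row index `b₀ ∈ [1,R] ∩ [1,R′]`; OFF-ROW ZERO for each; and the ROW identity `Σ_{j<J+1} [P j]·a j b₀ = Σ_{j<J+1} [P j]·h j b₀`.  THEN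
`Σ_{b∈[1,R]} Σ_{j<J+1} [P j]·a j b = Σ_{b∈[1,R′]} Σ_{j<J+1} [P j]·h j b` — the conclusion of `beta2ConesB.letter.v1` with `P j := IsOrd ρ α (jE ϖ^j) lam`,
`a j b := cellDiff₁ (j, b)`, `h j b := cellDiff₂ (j, b)`, `b₀ := m ∕ 2`. [cite: Kottwitz1986BaseChangeUnits, §1 pp. 240–241] [cite: Rogawski1990, §4.9 Prop. 4.9.1 (b) p. 55] -/
theorem coneSum_eq_coneSum_of_offRow_zero_of_row (P : ℕ → Prop) [DecidablePred P] (a h : ℕ → ℕ → ℤ) (J R R' b₀ : ℕ)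
    (hb₀ : b₀ ∈ Icc 1 R) (hb₀' : b₀ ∈ Icc 1 R')
    (hoffA : ∀ b ∈ Icc 1 R, b ≠ b₀ → ∀ j ∈ range (J + 1), P j → a j b = 0)
    (hoffH : ∀ b ∈ Icc 1 R', b ≠ b₀ → ∀ j ∈ range (J + 1), P j → h j b = 0)
    (hrow : ∑ j ∈ range (J + 1), (if P j then a j b₀ else 0) = ∑ j ∈ range (J + 1), (if P j then h j b₀ else 0)) :
    ∑ b ∈ Icc 1 R, ∑ j ∈ range (J + 1), (if P j then a j b else 0) = ∑ b ∈ Icc 1 R', ∑ j ∈ range (J + 1), (if P j then h j b else 0) := by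
  rw [coneSum_eq_row_of_offRow_zero P a J R b₀ hb₀ hoffA, coneSum_eq_row_of_offRow_zero P h J R' b₀ hb₀' hoffH, hrow]

/-- **HEAD (box-free form) — «OFF-ROW ZERO + GUARDED ROW ⟹ THE CONE LEDGER»**: as above, with the ROW identity stated between the GUARDED rows
`Σ_{j<J+1} [P j]·(if b₀ ∈ [1,R] then a j b₀ else 0) = Σ_{j<J+1} [P j]·(if b₀ ∈ [1,R′] then h j b₀ else 0)` — no membership hypothesis on `b₀` (a row outside a box counts as
an empty row). [cite: Kottwitz1986BaseChangeUnits, §1 pp. 240–241] [cite: Rogawski1990, §4.9 Prop. 4.9.1 (b) p. 55] -/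
theorem coneSum_eq_coneSum_of_offRow_zero_of_row_ite (P : ℕ → Prop) [DecidablePred P] (a h : ℕ → ℕ → ℤ) (J R R' b₀ : ℕ)
    (hoffA : ∀ b ∈ Icc 1 R, b ≠ b₀ → ∀ j ∈ range (J + 1), P j → a j b = 0)
    (hoffH : ∀ b ∈ Icc 1 R', b ≠ b₀ → ∀ j ∈ range (J + 1), P j → h j b = 0)
    (hrow : ∑ j ∈ range (J + 1), (if P j then (if b₀ ∈ Icc 1 R then a j b₀ else 0) else 0) =
      ∑ j ∈ range (J + 1), (if P j then (if b₀ ∈ Icc 1 R' then h j b₀ else 0) else 0)) :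
    ∑ b ∈ Icc 1 R, ∑ j ∈ range (J + 1), (if P j then a j b else 0) = ∑ b ∈ Icc 1 R', ∑ j ∈ range (J + 1), (if P j then h j b else 0) := by
  rw [coneSum_eq_row_ite_of_offRow_zero P a J R b₀ hoffA, coneSum_eq_row_ite_of_offRow_zero P h J R' b₀ hoffH, hrow]

end Summit.HodgeConjecture.HodgeConjecture.Cruxes.H413.F0P3cDyRamConeSumRowArithmetic
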